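import Summits.HodgeConjecture.HodgeConjecture.Theorems.F0P6aStubFROBCanSP
import HarnessLib

/-!
# `F0P6aStubFROB` — ★ RE-HOME of `Lines/F0_P6a_StubFROB.lean` (tree ED. 5 sha16 f9174234eccff5e5), PART 3 of 3 — tree lines :371–:522 (LAST part: the module the `Lines/` shim and consumers import; it transitively carries parts 1–2; «M-150j» early split: PART 2 is `Theorems/F0P6aStubFROBCanSP.lean`).

See PART 1 `Theorems/F0P6aStubFROBStubs.lean` for the full ★ re-home header and the original module docstring (verbatim there).  Same namespace (every fully-qualified name unchanged);
the scopes open at the cut (`noncomputable section` ∕ `namespace` ∕ `section`s) are re-opened below with their `variable` ∕ `open` ∕ `set_option` ∕ `omit` ∕ `include` ∕ `universe` lines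
replayed verbatim from the tree, in order; the code after the replay block is the tree bytes :371–:522, untouched.  HC_CM is proved only modulo the 7 printed citations (2 remaining: hLiu418 = stmt-HodgeConjecture-24832, h413 = stmt-HodgeConjecture-24833) until rung 0 closes; a re-home is count-neutral.
-/

-- ── replay of the scopes open at tree line :371 (verbatim) ──
set_option autoImplicit false
set_option linter.dupNamespace false
noncomputable section
namespace Summit.HodgeConjecture.HodgeConjecture.Cruxes.HLiu418.F0P6aStubFROB
open CategoryTheory CategoryTheory.Limits NumberField IsDedekindDomain MulAction
open scoped Matrix Polynomial Pointwise MonoidalCategory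
open Literature.NumberTheory.GaloisRepresentations
open Literature.NumberTheory.Automorphic Literature.NumberTheory.Automorphic.UnitaryGroup
open Literature.AlgebraicGeometry.ShimuraVarieties.UnitaryCanonicalModel
open Literature.NumberTheory.Automorphic.Liu2021.AppendixC
open Literature.AlgebraicGeometry.Motives (AlgPoints IntegralModel SchemeOver thickening thickeningGalAction thickeningLift specOver relFrobeniusOver frobeniusTwistOver frobSpec)
open Literature.NumberTheory.DiophantineGeometry (geomResidueField specialFibreFunctor specResidueField)
open Literature.AlgebraicGeometry.RelativeSpec (ActionOver)
open Literature.NumberTheory.EllipticCurves (genericFibre)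
open Summit.HodgeConjecture.HodgeConjecture.Cruxes.HLiu418.F0P6aModuliDatumDefs
open Summit.HodgeConjecture.HodgeConjecture.Cruxes.HLiu418.F0P6aRGDAssembly
open Summit.HodgeConjecture.HodgeConjecture.Cruxes.HLiu418.F0P6aDatumOfInputs
open Summit.HodgeConjecture.HodgeConjecture.Cruxes.HLiu418.F0P6aLineSpecialisation (spGeoOf canonicalLine_spGeoOf natCard_lineOf_eq_succ)
section Stubs
variable {F : Type} [Field F] [NumberField F] [IsCMField F] [IsGalois ℚ F] {ι₁ : F →+* ℂ}
    {Jstar : Matrix (Fin 2) (Fin 2) F}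
    {K₀ : C5.OpenCompactSubgroup ↥(finAdelic ↥(maximalRealSubfield F) F (IsCMField.complexConj F) 2 Jstar)}
    {S : RecordSystemGS F Jstar ι₁ K₀} {hU7ₛ : S.HeckeTranslateDefinedOver}
    {hJ : (Jstar.map (IsCMField.complexConj F))ᵀ = Jstar} {hJu : IsUnit Jstar}
    {Fi : Type} [Field Fi] [Algebra F Fi] [FiniteDimensional F Fi] [IsGalois F Fi] {Kc : C5.SmallLevel K₀} {G : Type} [Group G] [Finite G]
    {𝓜 : IntegralModel (𝓞 F) F ((thickening F Fi).obj (S.M.obj Kc))}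
    {w : HeightOneSpectrum (𝓞 F)} {hw : (IsCMField.complexConj F) • w ≠ w} {h𝓨 : (𝓜.localise w).IsSmoothProper 1}
    {θ : ActionOver (𝓜.localise w).total.hom ((Fi ≃ₐ[F] Fi) × G)}
    {e : Fi →ₐ[F] AlgebraicClosure (w.adicCompletion F)}
-- ── tree bytes :371–:522 ──

set_option maxHeartbeats 400000 in
set_option linter.unusedSectionVars false in  -- ED. 4: the `Stubs`-section instance binders stay in the PAID socket's statement (ED. 2∕3 precedent :217 :314 :339 :405)
/-- (ROOFGEO) **THE DOWNSTAIRS ROOF AT THE GEOMETRIC READING** — `Quot₀RoofLaw` at `sp := spGeoOf I 𝔡`: for every line `L` whose GEOMETRIC specialisation is the Frobenius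
kernel, the roof `Roof₀ … (frobIdealOf 𝔞 w γ) (red₀ y) (red₀ (quotΩ y L))` with rows (r1₀)–(r5₀) and the congruence relation (rL).  ORGAN (road (γ)∕(R3): ONE reduction `q̄` =
the legs' witness ★ `exists_roofLeg_specialFibre_of_downstairsDual_kerRows` (rows (r1₀)(r3₀)(r4₀)(r5₀)(K1)(K2)(K3)), (rL) = `hL_sch₀Of` ((rL-asm)) over `hlaw_{c•w}`
(`hlaw_cw_of_dockClauses`: `hdock` ← (ρ1-rebased, (F1)), `hkerq` ← (K2) ∘ ★ `isIdealTorsion_mul_of_roof`, `hF`, `hsat` + `I.hunr`), `hlaw_w` (W-DOCK `rL_W'`), (r2₀)∕banal by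
the cover's kernel).  Binders = `stub_ROOF0`'s without the abstract readings `𝔯`. [cite: Liu2021, Prop. D.8 (3) p. 135, pp. 136–138]
[cite: RapoportSmithlingZhang2020Diagonal, §4.3 (4.23) p. 21] [cite: Kottwitz1992, §5 (p. 391)] -/

theorem stub_ROOFGEO (I : RGDInputsAt F ι₁ Jstar K₀ S hU7ₛ hJ hJu Fi Kc G 𝓜 w hw h𝓨 θ e) [ExpChar (geomResidueField w) I.pChar]
    (𝔡 : ∀ xbar, DockAt I xbar)
    (quotΩ : ∀ y, LineOf I y → AlgPoints (S.M.obj Kc) (AlgebraicClosure (w.adicCompletion F)))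
    (translΩ : AlgPoints (S.M.obj Kc) (AlgebraicClosure (w.adicCompletion F)) → AlgPoints (S.M.obj Kc) (AlgebraicClosure (w.adicCompletion F)))
    (_hhecke : HeckeClause I quotΩ translΩ) (_hroof : RoofLink I quotΩ) (_hroof₂ : RoofLink₂ I translΩ)
    (_hunit : (UnitaryGroup.isUnit_placeForm Jstar hJu w).unit ∈ glInt 2 (w.adicCompletion F))
    (_hKc : UnitaryGroup.IsHyperspecialAt ↥(maximalRealSubfield F) F (IsCMField.complexConj F) 2 Jstar Kc.1.1
      (w.under (𝓞 ↥(maximalRealSubfield F))))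
    (_hdisj : haveI : AlgebraicGeometry.IsProper (𝓜.localise w).total.hom := h𝓨.2
      ∀ (β : Fi ≃ₐ[F] Fi) (P Q : AlgPoints (S.M.obj Kc) (AlgebraicClosure (w.adicCompletion F))),
        (𝓜.localise w).geomReductionMap (thickeningLift e (S.M.obj Kc) P) =
          AlgPoints.map ((specialFibreFunctor w).map (Over.isoMk (θ.aut (β, 1)) (θ.aut_comp (β, 1))).hom :
              (𝓜.localise w).reductionAt ⟶ (𝓜.localise w).reductionAt)
            ((𝓜.localise w).geomReductionMap (thickeningLift e (S.M.obj Kc) Q)) → β = 1)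
    (𝔞 : (Fi ≃ₐ[F] Fi) → Ideal (𝓞 F)) (𝔫 : (Fi ≃ₐ[F] Fi) → ℕ)
    (_hdiv : ∀ (σ : Field.absoluteGaloisGroup (w.adicCompletion F)), IsAbsArithFrob σ → ∀ γ : Fi ≃ₐ[F] Fi,
        ((AlgEquiv.restrictScalars F (Field.absoluteGaloisGroup.toAlgEquiv (w.adicCompletion F) σ) :
            AlgebraicClosure (w.adicCompletion F) ≃ₐ[F] AlgebraicClosure (w.adicCompletion F)) :
            AlgebraicClosure (w.adicCompletion F) →ₐ[F] AlgebraicClosure (w.adicCompletion F)).comp e = e.comp (γ : Fi →ₐ[F] Fi) →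
        w.asIdeal ∣ 𝔞 γ)
    (_hnorm : ∀ (σ : Field.absoluteGaloisGroup (w.adicCompletion F)), IsAbsArithFrob σ → ∀ γ : Fi ≃ₐ[F] Fi,
        ((AlgEquiv.restrictScalars F (Field.absoluteGaloisGroup.toAlgEquiv (w.adicCompletion F) σ) :
            AlgebraicClosure (w.adicCompletion F) ≃ₐ[F] AlgebraicClosure (w.adicCompletion F)) :
            AlgebraicClosure (w.adicCompletion F) →ₐ[F] AlgebraicClosure (w.adicCompletion F)).comp e = e.comp (γ : Fi →ₐ[F] Fi) →
        𝔫 γ = I.pChar ^ I.fDeg)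
    (_hcov : ∀ (σ : Field.absoluteGaloisGroup (w.adicCompletion F)), IsAbsArithFrob σ → ∀ γ : Fi ≃ₐ[F] Fi,
        ((AlgEquiv.restrictScalars F (Field.absoluteGaloisGroup.toAlgEquiv (w.adicCompletion F) σ) :
            AlgebraicClosure (w.adicCompletion F) ≃ₐ[F] AlgebraicClosure (w.adicCompletion F)) :
            AlgebraicClosure (w.adicCompletion F) →ₐ[F] AlgebraicClosure (w.adicCompletion F)).comp e = e.comp (γ : Fi →ₐ[F] Fi) →
        ∀ y : AlgPoints (S.M.obj Kc) (AlgebraicClosure (w.adicCompletion F)),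
          FrobCover₀ 𝓜 w I.univ I.act I.dual I.pol I.lvl I.pChar I.fDeg (𝔞 γ) (𝔫 γ)
            (red₀Of S Kc 𝓜 w h𝓨 e (σ • y)) (red₀Of S Kc 𝓜 w h𝓨 e y))
    (_hpin : ∀ (σ : Field.absoluteGaloisGroup (w.adicCompletion F)), IsAbsArithFrob σ → ∀ γ : Fi ≃ₐ[F] Fi,
        ((AlgEquiv.restrictScalars F (Field.absoluteGaloisGroup.toAlgEquiv (w.adicCompletion F) σ) :
            AlgebraicClosure (w.adicCompletion F) ≃ₐ[F] AlgebraicClosure (w.adicCompletion F)) :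
            AlgebraicClosure (w.adicCompletion F) →ₐ[F] AlgebraicClosure (w.adicCompletion F)).comp e = e.comp (γ : Fi →ₐ[F] Fi) →
        FrobPin₀ I (𝔞 γ))
    (_hspec : ∀ γ : Fi ≃ₐ[F] Fi, Ideal.span {((𝔫 γ : ℕ) : 𝓞 F)} = 𝔞 γ * (IsCMField.complexConj F) • 𝔞 γ) :
    Quot₀RoofLaw I 𝔡 quotΩ (spGeoOf I 𝔡) (frobIdealOf 𝔞 w) := by
  exact Summit.HodgeConjecture.HodgeConjecture.Cruxes.HLiu418.F0P6aStubFROBRoofGeoWiring.roofgeo_closed_of_sigma I 𝔡 quotΩ translΩ _hhecke _hroof _hroof₂ _hunit _hKc _hdisj 𝔞 𝔫 _hdiv _hnorm _hcov _hpin _hspec (fun y => ⟨(Summit.HodgeConjecture.HodgeConjecture.Cruxes.HLiu418.F0P6aLineSpecialisation.isoGenericOf_inv I y).trans rfl, (Summit.HodgeConjecture.HodgeConjecture.Cruxes.HLiu418.F0P6aLineSpecialisation.isoSpecialOf_inv I y).trans rfl⟩) (frobIdealOf 𝔞 w)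
    (fun σ hσ gam hγ => frobIdealOf_mul_eq 𝔞 w (_hdiv σ hσ gam hγ))

set_option maxHeartbeats 400000 in
set_option linter.unusedSectionVars false in
/-- (ROOF₀) [ED. 3 «STATE-2»: PAID ⇐ `stub_CANSP` + `stub_ROOFGEO`; statement byte-frozen] **THE DOWNSTAIRS ROOF OF THE CANONICAL TRANSLATE, WITH THE FROBENIUS-KERNEL LAW, for twist data PINNED BY A FROBENIUS COVER** (M-54: never read through
`I.twistIdeal`): from the roof link `_hroof : RoofLink I quotΩ` ((L4) upstairs roof through `K_L`), the downstairs readings `𝔯` (`sp`, `kerF`) and a Frobenius cover presenting `𝔞_γ`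
(`𝔭_w ∣ 𝔞_γ`, `n_γ = q`) AND ITS FROBENIUS PIN `_hpin` (π): `Quot₀RoofLaw I 𝔡 quotΩ 𝔯.spec.sp (frobIdealOf 𝔞 w)` — (r1₀)(r3₀)(r4₀)(r5₀) by ★ (ν8) `exists_specialFibre_hom_reduction`, (r2₀) by ★ α2a on the family
Serre cover, (rL) the CONGRUENCE RELATION (Q-FROB-3; blockwise: `c•w` by the guard `sp y L = kerF`, `w` by Cartier duality + heights, banal by the cover՚s kernel `A[𝔞_γ]` + (N-split)
★ `CMFieldGaloisPrimesOverSplit`). [cite: Liu2021, Prop. D.8 (3) p. 135, pp. 136–138] [cite: RapoportSmithlingZhang2020Diagonal, §4.3 (4.23) p. 21] [cite: Kottwitz1992, §5 (p. 391)] -/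
theorem stub_ROOF0 (I : RGDInputsAt F ι₁ Jstar K₀ S hU7ₛ hJ hJu Fi Kc G 𝓜 w hw h𝓨 θ e) [ExpChar (geomResidueField w) I.pChar]
    (𝔡 : ∀ xbar, DockAt I xbar)
    (quotΩ : ∀ y, LineOf I y → AlgPoints (S.M.obj Kc) (AlgebraicClosure (w.adicCompletion F)))
    (translΩ : AlgPoints (S.M.obj Kc) (AlgebraicClosure (w.adicCompletion F)) → AlgPoints (S.M.obj Kc) (AlgebraicClosure (w.adicCompletion F)))
    (_hhecke : HeckeClause I quotΩ translΩ) (_hroof : RoofLink I quotΩ) (_hroof₂ : RoofLink₂ I translΩ) (𝔯 : DownReadings I 𝔡 quotΩ translΩ)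
    (_hunit : (UnitaryGroup.isUnit_placeForm Jstar hJu w).unit ∈ glInt 2 (w.adicCompletion F))
    (_hKc : UnitaryGroup.IsHyperspecialAt ↥(maximalRealSubfield F) F (IsCMField.complexConj F) 2 Jstar Kc.1.1
      (w.under (𝓞 ↥(maximalRealSubfield F))))
    (_hdisj : haveI : AlgebraicGeometry.IsProper (𝓜.localise w).total.hom := h𝓨.2
      ∀ (β : Fi ≃ₐ[F] Fi) (P Q : AlgPoints (S.M.obj Kc) (AlgebraicClosure (w.adicCompletion F))),
        (𝓜.localise w).geomReductionMap (thickeningLift e (S.M.obj Kc) P) =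
          AlgPoints.map ((specialFibreFunctor w).map (Over.isoMk (θ.aut (β, 1)) (θ.aut_comp (β, 1))).hom :
              (𝓜.localise w).reductionAt ⟶ (𝓜.localise w).reductionAt)
            ((𝓜.localise w).geomReductionMap (thickeningLift e (S.M.obj Kc) Q)) → β = 1)
    (𝔞 : (Fi ≃ₐ[F] Fi) → Ideal (𝓞 F)) (𝔫 : (Fi ≃ₐ[F] Fi) → ℕ)
    (_hdiv : ∀ (σ : Field.absoluteGaloisGroup (w.adicCompletion F)), IsAbsArithFrob σ → ∀ γ : Fi ≃ₐ[F] Fi,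
        ((AlgEquiv.restrictScalars F (Field.absoluteGaloisGroup.toAlgEquiv (w.adicCompletion F) σ) :
            AlgebraicClosure (w.adicCompletion F) ≃ₐ[F] AlgebraicClosure (w.adicCompletion F)) :
            AlgebraicClosure (w.adicCompletion F) →ₐ[F] AlgebraicClosure (w.adicCompletion F)).comp e = e.comp (γ : Fi →ₐ[F] Fi) →
        w.asIdeal ∣ 𝔞 γ)
    (_hnorm : ∀ (σ : Field.absoluteGaloisGroup (w.adicCompletion F)), IsAbsArithFrob σ → ∀ γ : Fi ≃ₐ[F] Fi,
        ((AlgEquiv.restrictScalars F (Field.absoluteGaloisGroup.toAlgEquiv (w.adicCompletion F) σ) :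
            AlgebraicClosure (w.adicCompletion F) ≃ₐ[F] AlgebraicClosure (w.adicCompletion F)) :
            AlgebraicClosure (w.adicCompletion F) →ₐ[F] AlgebraicClosure (w.adicCompletion F)).comp e = e.comp (γ : Fi →ₐ[F] Fi) →
        𝔫 γ = I.pChar ^ I.fDeg)
    (_hcov : ∀ (σ : Field.absoluteGaloisGroup (w.adicCompletion F)), IsAbsArithFrob σ → ∀ γ : Fi ≃ₐ[F] Fi,
        ((AlgEquiv.restrictScalars F (Field.absoluteGaloisGroup.toAlgEquiv (w.adicCompletion F) σ) :
            AlgebraicClosure (w.adicCompletion F) ≃ₐ[F] AlgebraicClosure (w.adicCompletion F)) :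
            AlgebraicClosure (w.adicCompletion F) →ₐ[F] AlgebraicClosure (w.adicCompletion F)).comp e = e.comp (γ : Fi →ₐ[F] Fi) →
        ∀ y : AlgPoints (S.M.obj Kc) (AlgebraicClosure (w.adicCompletion F)),
          FrobCover₀ 𝓜 w I.univ I.act I.dual I.pol I.lvl I.pChar I.fDeg (𝔞 γ) (𝔫 γ)
            (red₀Of S Kc 𝓜 w h𝓨 e (σ • y)) (red₀Of S Kc 𝓜 w h𝓨 e y))
    (_hpin : ∀ (σ : Field.absoluteGaloisGroup (w.adicCompletion F)), IsAbsArithFrob σ → ∀ γ : Fi ≃ₐ[F] Fi,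
        ((AlgEquiv.restrictScalars F (Field.absoluteGaloisGroup.toAlgEquiv (w.adicCompletion F) σ) :
            AlgebraicClosure (w.adicCompletion F) ≃ₐ[F] AlgebraicClosure (w.adicCompletion F)) :
            AlgebraicClosure (w.adicCompletion F) →ₐ[F] AlgebraicClosure (w.adicCompletion F)).comp e = e.comp (γ : Fi →ₐ[F] Fi) →
        FrobPin₀ I (𝔞 γ))
    (_hspec : ∀ γ : Fi ≃ₐ[F] Fi, Ideal.span {((𝔫 γ : ℕ) : 𝓞 F)} = 𝔞 γ * (IsCMField.complexConj F) • 𝔞 γ) :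
    Quot₀RoofLaw I 𝔡 quotΩ 𝔯.spec.sp (frobIdealOf 𝔞 w) :=
  -- ED. 3 «STATE-2»: PAID from the transfer `stub_CANSP` (⇐ `stub_QUOTWD`) and the geometric roof `stub_ROOFGEO`
  roof0_of_cansp_geo I 𝔡 quotΩ (stub_CANSP I 𝔡 quotΩ translΩ _hhecke _hroof _hroof₂ 𝔯 _hunit _hKc _hdisj)
    (stub_ROOFGEO I 𝔡 quotΩ translΩ _hhecke _hroof _hroof₂ _hunit _hKc _hdisj 𝔞 𝔫 _hdiv _hnorm _hcov _hpin _hspec)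

set_option maxHeartbeats 400000 in
/-- **HEAD `stubFROB_of_parts`** — the tree socket `stub_FROB` (`Lines/F0_P6a_DatumOfInputs.lean` ED. 1 :554) TOKEN FOR TOKEN, sorry-free over `stub_TWISTCOVER0` and
`stub_ROOF0`: witnesses `twistIdeal := 𝔞`, `twistNorm := 𝔫`, `frobIdeal := frobIdealOf 𝔞 w` (so `frobIdeal γ * 𝔭_w = 𝔞 γ` by `frobIdealOf_mul_eq`), the cover and the guards
from the first stub, the roof from the second (reading the SAME `𝔞`). [cite: Liu2021, Prop. D.8 (3) p. 135, pp. 136–138] [cite: Shimura1998, §13.1 Thm. 1 (pp. 97–99)] -/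
theorem stubFROB_of_parts (I : RGDInputsAt F ι₁ Jstar K₀ S hU7ₛ hJ hJu Fi Kc G 𝓜 w hw h𝓨 θ e) [ExpChar (geomResidueField w) I.pChar]
    (𝔡 : ∀ xbar, DockAt I xbar)
    (quotΩ : ∀ y, LineOf I y → AlgPoints (S.M.obj Kc) (AlgebraicClosure (w.adicCompletion F)))
    (translΩ : AlgPoints (S.M.obj Kc) (AlgebraicClosure (w.adicCompletion F)) → AlgPoints (S.M.obj Kc) (AlgebraicClosure (w.adicCompletion F)))
    (_hhecke : HeckeClause I quotΩ translΩ) (_hroof : RoofLink I quotΩ) (_hroof₂ : RoofLink₂ I translΩ) (𝔯 : DownReadings I 𝔡 quotΩ translΩ)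
    (_hunit : (UnitaryGroup.isUnit_placeForm Jstar hJu w).unit ∈ glInt 2 (w.adicCompletion F))
    (_hKc : UnitaryGroup.IsHyperspecialAt ↥(maximalRealSubfield F) F (IsCMField.complexConj F) 2 Jstar Kc.1.1
      (w.under (𝓞 ↥(maximalRealSubfield F))))
    (_hdisj : haveI : AlgebraicGeometry.IsProper (𝓜.localise w).total.hom := h𝓨.2
      ∀ (β : Fi ≃ₐ[F] Fi) (P Q : AlgPoints (S.M.obj Kc) (AlgebraicClosure (w.adicCompletion F))),
        (𝓜.localise w).geomReductionMap (thickeningLift e (S.M.obj Kc) P) =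
          AlgPoints.map ((specialFibreFunctor w).map (Over.isoMk (θ.aut (β, 1)) (θ.aut_comp (β, 1))).hom :
              (𝓜.localise w).reductionAt ⟶ (𝓜.localise w).reductionAt)
            ((𝓜.localise w).geomReductionMap (thickeningLift e (S.M.obj Kc) Q)) → β = 1) :
    ∃ (twistIdeal : (Fi ≃ₐ[F] Fi) → Ideal (𝓞 F)) (twistNorm : (Fi ≃ₐ[F] Fi) → ℕ) (frobIdeal : (Fi ≃ₐ[F] Fi) → Ideal (𝓞 F)),
      (∀ (σ : Field.absoluteGaloisGroup (w.adicCompletion F)), IsAbsArithFrob σ → ∀ γ : Fi ≃ₐ[F] Fi,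
        ((AlgEquiv.restrictScalars F (Field.absoluteGaloisGroup.toAlgEquiv (w.adicCompletion F) σ) :
            AlgebraicClosure (w.adicCompletion F) ≃ₐ[F] AlgebraicClosure (w.adicCompletion F)) :
            AlgebraicClosure (w.adicCompletion F) →ₐ[F] AlgebraicClosure (w.adicCompletion F)).comp e = e.comp (γ : Fi →ₐ[F] Fi) →
        frobIdeal γ * w.asIdeal = twistIdeal γ) ∧
      (∀ (σ : Field.absoluteGaloisGroup (w.adicCompletion F)), IsAbsArithFrob σ → ∀ γ : Fi ≃ₐ[F] Fi,
        ((AlgEquiv.restrictScalars F (Field.absoluteGaloisGroup.toAlgEquiv (w.adicCompletion F) σ) :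
            AlgebraicClosure (w.adicCompletion F) ≃ₐ[F] AlgebraicClosure (w.adicCompletion F)) :
            AlgebraicClosure (w.adicCompletion F) →ₐ[F] AlgebraicClosure (w.adicCompletion F)).comp e = e.comp (γ : Fi →ₐ[F] Fi) →
        twistNorm γ = I.pChar ^ I.fDeg) ∧
      (∀ (σ : Field.absoluteGaloisGroup (w.adicCompletion F)), IsAbsArithFrob σ → ∀ γ : Fi ≃ₐ[F] Fi,
        ((AlgEquiv.restrictScalars F (Field.absoluteGaloisGroup.toAlgEquiv (w.adicCompletion F) σ) :
            AlgebraicClosure (w.adicCompletion F) ≃ₐ[F] AlgebraicClosure (w.adicCompletion F)) :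
            AlgebraicClosure (w.adicCompletion F) →ₐ[F] AlgebraicClosure (w.adicCompletion F)).comp e = e.comp (γ : Fi →ₐ[F] Fi) →
        ∀ y : AlgPoints (S.M.obj Kc) (AlgebraicClosure (w.adicCompletion F)),
          FrobCover₀ 𝓜 w I.univ I.act I.dual I.pol I.lvl I.pChar I.fDeg (twistIdeal γ) (twistNorm γ)
            (red₀Of S Kc 𝓜 w h𝓨 e (σ • y)) (red₀Of S Kc 𝓜 w h𝓨 e y)) ∧
      (∀ γ : Fi ≃ₐ[F] Fi, twistIdeal γ ⊔ Ideal.span {((I.N : ℕ) : 𝓞 F)} = ⊤) ∧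
      (∀ γ : Fi ≃ₐ[F] Fi, twistIdeal γ ≠ ⊥) ∧
      Quot₀RoofLaw I 𝔡 quotΩ 𝔯.spec.sp frobIdeal := by
  obtain ⟨𝔞, 𝔫, hcop, hne, hdiv, hnorm, hcov, hpin, hspec⟩ := stub_TWISTCOVER0 I 𝔡 quotΩ translΩ _hhecke _hroof _hroof₂ 𝔯 _hunit _hKc _hdisj
  exact ⟨𝔞, 𝔫, frobIdealOf 𝔞 w, fun σ hσ γ hγ => frobIdealOf_mul_eq 𝔞 w (hdiv σ hσ γ hγ), hnorm, hcov, hcop, hne,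
    stub_ROOF0 I 𝔡 quotΩ translΩ _hhecke _hroof _hroof₂ 𝔯 _hunit _hKc _hdisj 𝔞 𝔫 hdiv hnorm hcov hpin hspec⟩

-- (★ re-home: tree lines :515–:516 of the `Lines` workfile — a socket-tie `example` naming a hub `stub_*` — are NOT re-homed; the `Lines/` shim keeps them.)

end Stubs

end Summit.HodgeConjecture.HodgeConjecture.Cruxes.HLiu418.F0P6aStubFROB

end
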